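import Literature.MathematicalPhysics.QuantumFieldTheory.BalabanImbrieJaffe1984to88.BIJ88SecondOrder5133

/-!
# `BalabanImbrieJaffe1984to88.BIJ88DexpCondMean305` — T. Bałaban, J. Imbrie, A. Jaffe, *Effective action and cluster properties of the abelian
Higgs model*, Commun. Math. Phys. **114** (1988) 257–315 [BalabanImbrieJaffe1988], Sect. 5.13 p. 305–307 [PDF 49–51] (with [Balaban1982Higgs2]
(2.28)–(2.29) p. 563): **THE PULLED-DOWN FACTOR `D_n` AS A DOUBLE SITE SUM, AND THE CONDITIONAL-MEAN CONFIGURATION** — bookkeeping for the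
smoothness-free form of the p. 307 join mechanism (*"Each time some □_i's are joined, we have s-derivatives, which produce functional derivatives,
chains of covariances C_ω(α) …  If the walk ω(α) wanders through more than a few cubes, we begin to pickup factors e^{−cr(e_k)}"*): p13's engine
pulls down `D_n = Σ_{l≠n}s_l⟨□_nΦ,Δ□_lΦ⟩` (p. 305 *"the first derivative produces a term ⟨Σ_{j≠i} s_j⟨□_iΦ, Δ□_jΦ⟩; Π f(□_i)⟩_{s_Γ}"*,
`BIJ88SecondOrder5133.Dfun`); here it is written as the quadratic form `Σ_{x,y} a_{xy}φ_xφ_y` on sites, and the CONDITIONAL-MEAN configuration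
`cm(φ) = (μ(φ↾Λᶜ) on Λ, φ on Λᶜ)`, `μ(y) = A_Λ⁻¹(f↾Λ − A_{ΛΛᶜ}y)` ([Balaban1982Higgs2] (2.28)–(2.29), tree carrier `B2Eq228Conditioning.condShift`),
is shown measurable, of affine growth, and such that `D_n ∘ cm` times a bounded observable is integrable against `e^{−½⟨φ,Δ_sφ⟩}e^{⟨f,φ⟩}` —
the hypotheses of the sequel `BIJ88DexpCondMeanCov305` (`∂{n}⟨H⟩(s) = −⟨D_n∘cm ; H⟩_s`).

statement-level skeleton of published theorems with citation tags; proofs where landed; nothing here is a claim about the Yang–Mills mass gap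

PDF held: `paper:balaban1988-cmp114-bij-abelian-higgs-effective-action` (journal page = PDF page + 256); p. 305 (text layer p0049) and p. 307
(p0051) as quoted.

WHAT IS PROVED (unit `lit-balaban-p36`, generation 19 of the Phase-2 proof seat p36; SKELETON rows C2.Eq5.14.3-5.14.4 / C2.Eq5.13.3-5.13.4 of
`HOME/lit-balaban-r16/ROWS-C2-part2.md`, owner r16 — engine-level infrastructure for the re-scoped flip item (v2.253); 0 definitions, 0 `Prop`
facts, theorems only).
* §1 `blockPair_eq_sum_sum`, **`Dfun_eq_sum_sum`** (`D_n(ψ) = Σ_{x,y} a_{xy}ψ_xψ_y`, `a_{xy} = [□x = n][□y ≠ n]s_{□y}Δ_{xy}`), `coeff_eq_zero_of_not`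
  (the coefficients live on `Λ × Λ` when `□_n ⊂ Λ` couples only into `Λ`).
* §2 `measurable_cm_apply`, `abs_apply_le`, **`abs_cm_apply_le`** (affine growth of `cm`), `one_add_sq_le_exp`; Gaussian-growth integrability
  `integrable_apply_mul_apply_mul` (`φ_xφ_y·H`), `integrable_cm_mul_cm_mul` (`cm_x cm_y·H`), `integrable_Dfun_cm_sub_mul`,
  `integrable_abs_Dfun_cm_sub_mul` (`(D_n∘cm − a)·H`, `|D_n∘cm − a|·H`); linearity of p13's `num`: `num_const_mul`, `num_add`, `num_sum_sum`.
HONEST SCOPE: bookkeeping only (finite sums, measurability, integrability); no estimate.  Imports `BIJ88SecondOrder5133` (p13); modifies nothing.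
NOT summit progress; NOT continuum; NOT Clay.  Cell `lit-balaban` Phase 2, seat p36 gen 19 (owner r16, referee ref-5).
-/

noncomputable section

open MeasureTheory Matrix Finset Filter
open scoped BigOperators

namespace Literature.MathematicalPhysics.QuantumFieldTheory.BalabanImbrieJaffe1984to88.BIJ88DexpCondMean305

open Literature.MathematicalPhysics.QuantumFieldTheory.Balaban1983to89
open B2Eq228Conditioning (In Out resIn resOut glue blkIn blkMix condShift weight source continuous_condShift measurable_glue
  measurable_resOut)
open BIJ88DirichletForms305 (interpForm boxProj boxProj_mulVec_apply interpForm_posDef quadForm_interpForm_ge)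
open BIJ88DirichletDeriv305 (blockPair)
open BIJ88SecondOrder5133 (num Dfun integrable_growth_of_lower)

variable {α I : Type} [Fintype α] [DecidableEq α] [Fintype I] [DecidableEq I] (blk : α → I) (Δ : Matrix α α ℝ)

/-! ## §1 `D_n` as a double site sum -/

omit [Fintype I] in
/-- `⟨□_nψ, Δ□_lψ⟩ = Σ_{x,y} [□x = n][□y = l] Δ_{xy} ψ_x ψ_y`. [cite: BalabanImbrieJaffe1988, §5.13 p.305] -/
theorem blockPair_eq_sum_sum (ψ : α → ℝ) (n l : I) :
    blockPair blk Δ ψ n l = ∑ x, ∑ y, (if blk x = n ∧ blk y = l then Δ x y else 0) * (ψ x * ψ y) := by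
  have hn : boxProj blk n *ᵥ ψ = fun x => if blk x = n then ψ x else 0 := funext (boxProj_mulVec_apply blk n ψ)
  have hl : boxProj blk l *ᵥ ψ = fun y => if blk y = l then ψ y else 0 := funext (boxProj_mulVec_apply blk l ψ)
  rw [blockPair, hn, hl]
  simp only [dotProduct, mulVec]
  refine Finset.sum_congr rfl fun x _ => ?_
  rw [Finset.mul_sum]
  refine Finset.sum_congr rfl fun y _ => ?_
  by_cases hx : blk x = n <;> by_cases hy : blk y = l <;> simp [hx, hy]
  ring

/-- **`D_n(s,ψ) = Σ_{x,y} a_{xy} ψ_xψ_y`**, `a_{xy} = s_{□y}Δ_{xy}` if `□x = n ≠ □y` and `0` otherwise. [cite: BalabanImbrieJaffe1988, §5.13 p.305] -/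
theorem Dfun_eq_sum_sum (s : I → ℝ) (n : I) (ψ : α → ℝ) :
    Dfun blk Δ s n ψ = ∑ x, ∑ y, (if blk x = n ∧ blk y ≠ n then s (blk y) * Δ x y else 0) * (ψ x * ψ y) := by
  simp only [Dfun, blockPair_eq_sum_sum, Finset.mul_sum]
  rw [Finset.sum_comm]
  refine Finset.sum_congr rfl fun x _ => ?_
  rw [Finset.sum_comm]
  refine Finset.sum_congr rfl fun y _ => ?_
  by_cases hx : blk x = n
  · by_cases hyn : blk y = n
    · rw [if_neg (fun h => h.2 hyn), zero_mul]
      refine Finset.sum_eq_zero fun l hl => ?_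
      have hl' : blk y ≠ l := by rw [hyn]; exact (Finset.mem_erase.1 hl).1.symm
      rw [if_neg (fun h => hl' h.2), zero_mul, mul_zero]
    · rw [if_pos ⟨hx, hyn⟩, Finset.sum_eq_single (blk y)]
      · rw [if_pos ⟨hx, rfl⟩]; ring
      · intro l _ hl
        rw [if_neg (fun h => hl h.2.symm), zero_mul, mul_zero]
      · intro h
        exact absurd (Finset.mem_erase.2 ⟨hyn, Finset.mem_univ _⟩) h
  · rw [if_neg (fun h => hx h.1), zero_mul]
    refine Finset.sum_eq_zero fun l _ => ?_
    rw [if_neg (fun h => hx h.1), zero_mul, mul_zero]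

omit [Fintype α] [DecidableEq α] [Fintype I] in
/-- The coefficients of `D_n` vanish unless both sites are integrated (`□_n ⊂ Λ` and `□_n` couples only into `Λ`).
[cite: BalabanImbrieJaffe1988, §5.13 p.305] -/
theorem coeff_eq_zero_of_not (p : α → Prop) (s : I → ℝ) {n : I} (hpn : ∀ x, blk x = n → p x)
    (hfar : ∀ x y, blk x = n → ¬ p y → Δ x y = 0) {x y : α} (h : ¬ (p x ∧ p y)) :
    (if blk x = n ∧ blk y ≠ n then s (blk y) * Δ x y else 0) = 0 := by
  by_cases hxy : blk x = n ∧ blk y ≠ n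
  · rw [if_pos hxy]
    have hx : p x := hpn x hxy.1
    have hy : ¬ p y := fun hy => h ⟨hx, hy⟩
    rw [hfar x y hxy.1 hy, mul_zero]
  · rw [if_neg hxy]

/-! ## §2 The conditional-mean configuration: measurability, affine growth, integrability -/

section Growth

variable (p : α → Prop) [DecidablePred p] (A : Matrix α α ℝ) (f : α → ℝ)

omit [Fintype I] [DecidableEq I] in
/-- `φ ↦ cm(φ)_x` is measurable (`cm(φ) = (μ(φ↾Λᶜ) on Λ, φ on Λᶜ)`, `μ` continuous). [cite: Balaban1982Higgs2, (2.28) p.563] -/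
theorem measurable_cm_apply (x : α) :
    Measurable fun φ : α → ℝ => glue p (condShift p A f (resOut p φ)) (resOut p φ) x := by
  have h1 : Measurable fun φ : α → ℝ => (condShift p A f (resOut p φ), resOut p φ) :=
    ((continuous_condShift p A f).measurable.comp (measurable_resOut p)).prodMk (measurable_resOut p)
  exact (measurable_pi_apply x).comp ((measurable_glue p).comp h1)

omit [DecidableEq α] [Fintype I] [DecidableEq I] in
/-- `|φ_x| ≤ (1 + ‖φ‖²)/2`. [folklore] [cite: BalabanImbrieJaffe1988, §5.13 p.305] -/
theorem abs_apply_le (φ : α → ℝ) (x : α) : |φ x| ≤ (1 + φ ⬝ᵥ φ) / 2 := by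
  have h : φ x ^ 2 ≤ φ ⬝ᵥ φ := by
    rw [dotProduct, sq]
    exact Finset.single_le_sum (fun y _ => mul_self_nonneg (φ y)) (Finset.mem_univ x)
  rw [← sq_abs] at h
  nlinarith [sq_nonneg (|φ x| - 1)]

omit [Fintype I] [DecidableEq I] in
/-- **Affine growth of the conditional mean**: `|cm(φ)_x| ≤ C_x(1 + ‖φ‖²)` for some `C_x ≥ 0`. [cite: Balaban1982Higgs2, (2.29) p.563] -/
theorem abs_cm_apply_le (x : α) : ∃ C : ℝ, 0 ≤ C ∧ ∀ φ : α → ℝ,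
    |glue p (condShift p A f (resOut p φ)) (resOut p φ) x| ≤ C * (1 + φ ⬝ᵥ φ) := by
  by_cases hx : p x
  · -- `μ(y)_x = (A_Λ⁻¹f↾Λ)_x − Σ_j (A_Λ⁻¹A_{ΛΛᶜ})_{xj} y_j`
    set M : Matrix (In p) (In p) ℝ := (blkIn p A)⁻¹ with hM
    refine ⟨|(M *ᵥ resIn p f) ⟨x, hx⟩| + ∑ j, |(M * blkMix p A) ⟨x, hx⟩ j|, by positivity, fun φ => ?_⟩
    have hglue : glue p (condShift p A f (resOut p φ)) (resOut p φ) x = condShift p A f (resOut p φ) ⟨x, hx⟩ := by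
      simp [glue, hx]
    rw [hglue, condShift, mulVec_sub, Pi.sub_apply, ← hM, mulVec_mulVec]
    have h0 : 0 ≤ φ ⬝ᵥ φ := by rw [dotProduct]; exact Finset.sum_nonneg fun y _ => mul_self_nonneg _
    have h1 : |((M * blkMix p A) *ᵥ resOut p φ) ⟨x, hx⟩| ≤ (∑ j, |(M * blkMix p A) ⟨x, hx⟩ j|) * (1 + φ ⬝ᵥ φ) := by
      rw [mulVec, dotProduct, Finset.sum_mul]
      refine (Finset.abs_sum_le_sum_abs _ _).trans (Finset.sum_le_sum fun j _ => ?_)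
      rw [abs_mul]
      have hj : |resOut p φ j| ≤ 1 + φ ⬝ᵥ φ := by
        have := abs_apply_le φ (j : α)
        simp only [resOut]
        linarith
      exact mul_le_mul_of_nonneg_left hj (abs_nonneg _)
    calc |(M *ᵥ resIn p f) ⟨x, hx⟩ - ((M * blkMix p A) *ᵥ resOut p φ) ⟨x, hx⟩|
        ≤ |(M *ᵥ resIn p f) ⟨x, hx⟩| + |((M * blkMix p A) *ᵥ resOut p φ) ⟨x, hx⟩| := abs_sub _ _
      _ ≤ |(M *ᵥ resIn p f) ⟨x, hx⟩| * (1 + φ ⬝ᵥ φ) + (∑ j, |(M * blkMix p A) ⟨x, hx⟩ j|) * (1 + φ ⬝ᵥ φ) :=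
          add_le_add (le_mul_of_one_le_right (abs_nonneg _) (by linarith)) h1
      _ = _ := by ring
  · refine ⟨1, zero_le_one, fun φ => ?_⟩
    have hglue : glue p (condShift p A f (resOut p φ)) (resOut p φ) x = φ x := by
      simp [glue, hx, resOut]
    rw [hglue, one_mul]
    have := abs_apply_le φ x
    have h0 : 0 ≤ φ ⬝ᵥ φ := by rw [dotProduct]; exact Finset.sum_nonneg fun y _ => mul_self_nonneg _
    linarith

omit [DecidableEq α] [Fintype I] [DecidableEq I] in
/-- `(1 + u)² ≤ (2 + 4ε⁻²)e^{εu}` for `u ≥ 0`, `ε > 0`. [folklore] [cite: BalabanImbrieJaffe1988, §5.13 p.305] -/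
theorem one_add_sq_le_exp {ε u : ℝ} (hε : 0 < ε) (hu : 0 ≤ u) : (1 + u) ^ 2 ≤ (2 + 4 * (ε ^ 2)⁻¹) * Real.exp (ε * u) := by
  have h1 : 1 ≤ Real.exp (ε * u) := Real.one_le_exp (mul_nonneg hε.le hu)
  have h2 : (ε * u) ^ 2 / 2 ≤ Real.exp (ε * u) := by
    have := Real.pow_div_factorial_le_exp (ε * u) (mul_nonneg hε.le hu) 2
    simpa using this
  have hε2 : 0 < ε ^ 2 := pow_pos hε 2
  have h3 : u ^ 2 ≤ 2 * (ε ^ 2)⁻¹ * Real.exp (ε * u) := by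
    rw [mul_pow] at h2
    have := (div_le_iff₀ (by norm_num : (0:ℝ) < 2)).1 h2
    calc u ^ 2 = (ε ^ 2)⁻¹ * (ε ^ 2 * u ^ 2) := by field_simp
      _ ≤ (ε ^ 2)⁻¹ * (Real.exp (ε * u) * 2) := mul_le_mul_of_nonneg_left this (inv_nonneg.2 hε2.le)
      _ = _ := by ring
  have h4 : (1 + u) ^ 2 ≤ 2 + 2 * u ^ 2 := by nlinarith [sq_nonneg (u - 1)]
  have h5 : (2 + 4 * (ε ^ 2)⁻¹) * Real.exp (ε * u) = 2 * Real.exp (ε * u) + 2 * (2 * (ε ^ 2)⁻¹ * Real.exp (ε * u)) := by ring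
  rw [h5]
  linarith [h4, h1, h3]

end Growth

section Engine

variable {Δ} {c : ℝ} (hcΔ : ∀ v, c * (v ⬝ᵥ v) ≤ v ⬝ᵥ (Δ *ᵥ v))
  (f : α → ℝ) {s : I → ℝ} (hs : ∀ l, 0 ≤ s l ∧ s l ≤ 1)
  (p : α → Prop) [DecidablePred p]
  {H : (α → ℝ) → ℝ} (hHm : Measurable H) {K₀ : ℝ} (hK : ∀ φ, ‖H φ‖ ≤ K₀)

include hcΔ hs hHm hK in
/-- `ψ_xψ_y·H` is integrable against `e^{−½⟨φ,Δ_sφ⟩}e^{⟨f,φ⟩}` (`H` bounded measurable). [cite: BalabanImbrieJaffe1988, §5.13 p.305] -/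
theorem integrable_apply_mul_apply_mul (hc : 0 < c) (x y : α) :
    Integrable fun φ : α → ℝ => φ x * φ y * H φ * (weight (interpForm blk Δ s) φ * source f φ) := by
  have hε : 2 * (c / 4) < c := by linarith
  have hε0 : 0 < c / 4 := by linarith
  have hK0 : 0 ≤ K₀ := (norm_nonneg _).trans (hK 0)
  refine integrable_growth_of_lower (quadForm_interpForm_ge blk hcΔ hs) f
    (((measurable_pi_apply x).mul (measurable_pi_apply y)).mul hHm).aestronglyMeasurable hε (K₀ := K₀ * (c / 4)⁻¹) fun φ => ?_
  have h1 : |φ x * φ y| ≤ φ ⬝ᵥ φ := by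
    rw [abs_mul]
    have hi := abs_apply_le φ x
    have hj := abs_apply_le φ y
    have h0 : 0 ≤ φ ⬝ᵥ φ := by rw [dotProduct]; exact Finset.sum_nonneg fun z _ => mul_self_nonneg _
    have hsq : ∀ z, φ z ^ 2 ≤ φ ⬝ᵥ φ := fun z => by
      rw [dotProduct, sq]; exact Finset.single_le_sum (fun w _ => mul_self_nonneg (φ w)) (Finset.mem_univ z)
    have hx2 := hsq x
    have hy2 := hsq y
    rw [← sq_abs] at hx2 hy2
    nlinarith [sq_nonneg (|φ x| - |φ y|), abs_nonneg (φ x), abs_nonneg (φ y)]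
  have h2 : φ ⬝ᵥ φ ≤ (c / 4)⁻¹ * Real.exp (c / 4 * (φ ⬝ᵥ φ)) := by
    have h := Real.add_one_le_exp (c / 4 * (φ ⬝ᵥ φ))
    rw [le_inv_mul_iff₀ hε0]
    linarith
  rw [norm_mul, Real.norm_eq_abs]
  calc |φ x * φ y| * ‖H φ‖ ≤ (c / 4)⁻¹ * Real.exp (c / 4 * (φ ⬝ᵥ φ)) * K₀ := mul_le_mul (h1.trans h2) (hK φ) (norm_nonneg _) (by positivity)
    _ = K₀ * (c / 4)⁻¹ * Real.exp (c / 4 * (φ ⬝ᵥ φ)) := by ring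

include hcΔ hs hHm hK in
/-- `cm_x cm_y·H` is integrable against `e^{−½⟨φ,Δ_sφ⟩}e^{⟨f,φ⟩}` (affine growth of the conditional mean). [cite: Balaban1982Higgs2, (2.28) p.563] -/
theorem integrable_cm_mul_cm_mul (hc : 0 < c) (A : Matrix α α ℝ) (x y : α) :
    Integrable fun φ : α → ℝ => glue p (condShift p A f (resOut p φ)) (resOut p φ) x *
      glue p (condShift p A f (resOut p φ)) (resOut p φ) y * H φ * (weight (interpForm blk Δ s) φ * source f φ) := by
  obtain ⟨Cx, hCx0, hCx⟩ := abs_cm_apply_le p A f x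
  obtain ⟨Cy, hCy0, hCy⟩ := abs_cm_apply_le p A f y
  have hε : 2 * (c / 4) < c := by linarith
  have hε0 : 0 < c / 4 := by linarith
  have hK0 : 0 ≤ K₀ := (norm_nonneg _).trans (hK 0)
  refine integrable_growth_of_lower (quadForm_interpForm_ge blk hcΔ hs) f
    (((measurable_cm_apply p A f x).mul (measurable_cm_apply p A f y)).mul hHm).aestronglyMeasurable hε
    (K₀ := Cx * Cy * K₀ * (2 + 4 * ((c / 4) ^ 2)⁻¹)) fun φ => ?_
  have h0 : 0 ≤ φ ⬝ᵥ φ := by rw [dotProduct]; exact Finset.sum_nonneg fun z _ => mul_self_nonneg _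
  have h3 := one_add_sq_le_exp hε0 h0
  rw [norm_mul, norm_mul, Real.norm_eq_abs, Real.norm_eq_abs]
  calc |glue p (condShift p A f (resOut p φ)) (resOut p φ) x| * |glue p (condShift p A f (resOut p φ)) (resOut p φ) y| * ‖H φ‖
      ≤ Cx * (1 + φ ⬝ᵥ φ) * (Cy * (1 + φ ⬝ᵥ φ)) * K₀ :=
        mul_le_mul (mul_le_mul (hCx φ) (hCy φ) (abs_nonneg _) (by positivity)) (hK φ) (norm_nonneg _) (by positivity)
    _ = Cx * Cy * K₀ * (1 + φ ⬝ᵥ φ) ^ 2 := by ring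
    _ ≤ Cx * Cy * K₀ * ((2 + 4 * ((c / 4) ^ 2)⁻¹) * Real.exp (c / 4 * (φ ⬝ᵥ φ))) := mul_le_mul_of_nonneg_left h3 (by positivity)
    _ = _ := by ring

include hcΔ hs hHm hK in
/-- `(D_n∘cm − a)·H` is integrable against `e^{−½⟨φ,Δ_sφ⟩}e^{⟨f,φ⟩}`. [cite: BalabanImbrieJaffe1988, §5.13 p.305] -/
theorem integrable_Dfun_cm_sub_mul (hc : 0 < c) (A : Matrix α α ℝ) (n : I) (a : ℝ) :
    Integrable fun φ : α → ℝ => (Dfun blk Δ s n (glue p (condShift p A f (resOut p φ)) (resOut p φ)) - a) * H φ *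
      (weight (interpForm blk Δ s) φ * source f φ) := by
  have hterm : ∀ x y : α, Integrable fun φ : α → ℝ =>
      (if blk x = n ∧ blk y ≠ n then s (blk y) * Δ x y else 0) *
        (glue p (condShift p A f (resOut p φ)) (resOut p φ) x * glue p (condShift p A f (resOut p φ)) (resOut p φ) y) * H φ *
          (weight (interpForm blk Δ s) φ * source f φ) := fun x y => by
    have h := (integrable_cm_mul_cm_mul blk hcΔ f hs p hHm hK hc A x y).const_mul (if blk x = n ∧ blk y ≠ n then s (blk y) * Δ x y else 0)
    refine h.congr (Eventually.of_forall fun φ => ?_)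
    simp only; ring
  have hsum : Integrable fun φ : α → ℝ => Dfun blk Δ s n (glue p (condShift p A f (resOut p φ)) (resOut p φ)) * H φ *
      (weight (interpForm blk Δ s) φ * source f φ) := by
    have h := integrable_finsetSum univ fun x _ => integrable_finsetSum univ fun y _ => hterm x y
    refine h.congr (Eventually.of_forall fun φ => ?_)
    simp only [Dfun_eq_sum_sum, Finset.sum_mul]
  have hconst : Integrable fun φ : α → ℝ => a * H φ * (weight (interpForm blk Δ s) φ * source f φ) := by
    have hε : 2 * (c / 4) < c := by linarith
    have hK0 : 0 ≤ K₀ := (norm_nonneg _).trans (hK 0)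
    refine integrable_growth_of_lower (quadForm_interpForm_ge blk hcΔ hs) f (hHm.const_mul a).aestronglyMeasurable hε
      (K₀ := |a| * K₀) fun φ => ?_
    rw [norm_mul, Real.norm_eq_abs]
    have h0 : 0 ≤ φ ⬝ᵥ φ := by rw [dotProduct]; exact Finset.sum_nonneg fun z _ => mul_self_nonneg _
    have h1 : 1 ≤ Real.exp (c / 4 * (φ ⬝ᵥ φ)) := Real.one_le_exp (by positivity)
    calc |a| * ‖H φ‖ ≤ |a| * K₀ := mul_le_mul_of_nonneg_left (hK φ) (abs_nonneg _)
      _ ≤ |a| * K₀ * Real.exp (c / 4 * (φ ⬝ᵥ φ)) := le_mul_of_one_le_right (by positivity) h1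
  refine (hsum.sub hconst).congr (Eventually.of_forall fun φ => ?_)
  simp only [Pi.sub_apply]; ring

include hcΔ hs hHm hK in
/-- `|D_n∘cm − a|·H` is integrable against `e^{−½⟨φ,Δ_sφ⟩}e^{⟨f,φ⟩}`. [cite: BalabanImbrieJaffe1988, §5.13 p.305] -/
theorem integrable_abs_Dfun_cm_sub_mul (hc : 0 < c) (A : Matrix α α ℝ) (n : I) (a : ℝ) :
    Integrable fun φ : α → ℝ => |Dfun blk Δ s n (glue p (condShift p A f (resOut p φ)) (resOut p φ)) - a| * H φ *
      (weight (interpForm blk Δ s) φ * source f φ) := by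
  have hdiff := integrable_Dfun_cm_sub_mul blk hcΔ f hs p hHm hK hc A n a
  have hcm : Measurable fun φ : α → ℝ => glue p (condShift p A f (resOut p φ)) (resOut p φ) :=
    measurable_pi_lambda _ fun x => measurable_cm_apply p A f x
  have hX : Measurable fun φ : α → ℝ => Dfun blk Δ s n (glue p (condShift p A f (resOut p φ)) (resOut p φ)) := by
    simp only [Dfun]
    exact (BIJ88SecondOrder5133.continuous_D blk Δ s n).measurable.comp hcm
  have hmeas : AEStronglyMeasurable (fun φ : α → ℝ =>
      |Dfun blk Δ s n (glue p (condShift p A f (resOut p φ)) (resOut p φ)) - a| * H φ *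
        (weight (interpForm blk Δ s) φ * source f φ)) volume :=
    (((hX.sub_const a).abs.mul hHm).mul ((B2Eq228Conditioning.continuous_weight _).measurable.mul
      (B2Eq228Conditioning.continuous_source f).measurable)).aestronglyMeasurable
  refine hdiff.norm.mono' hmeas (Eventually.of_forall fun φ => le_of_eq ?_)
  simp only [norm_mul, Real.norm_eq_abs, abs_abs]

end Engine


/-! ## §3 Linearity of `N` -/

section Num

variable {Δ}

/-- `N(c·G) = c·N(G)`. [cite: BalabanImbrieJaffe1988, §5.13 p.305] -/
theorem num_const_mul (f : α → ℝ) (s : I → ℝ) (a : ℝ) (G : (α → ℝ) → ℝ) :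
    num blk Δ f (fun φ => a * G φ) s = a * num blk Δ f G s := by
  simp only [num, mul_assoc]
  exact integral_const_mul a _

/-- `N(G₁ + G₂) = N(G₁) + N(G₂)` (both integrable). [cite: BalabanImbrieJaffe1988, §5.13 p.305] -/
theorem num_add (f : α → ℝ) (s : I → ℝ) {G₁ G₂ : (α → ℝ) → ℝ}
    (h₁ : Integrable fun φ : α → ℝ => G₁ φ * (weight (interpForm blk Δ s) φ * source f φ))
    (h₂ : Integrable fun φ : α → ℝ => G₂ φ * (weight (interpForm blk Δ s) φ * source f φ)) :
    num blk Δ f (fun φ => G₁ φ + G₂ φ) s = num blk Δ f G₁ s + num blk Δ f G₂ s := by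
  simp only [num, add_mul]
  exact integral_add h₁ h₂

/-- `N(Σ_{x,y} g_{xy}) = Σ_{x,y} N(g_{xy})` (all integrable). [cite: BalabanImbrieJaffe1988, §5.13 p.305] -/
theorem num_sum_sum (f : α → ℝ) (s : I → ℝ) (g : α → α → (α → ℝ) → ℝ)
    (hg : ∀ x y, Integrable fun φ : α → ℝ => g x y φ * (weight (interpForm blk Δ s) φ * source f φ)) :
    num blk Δ f (fun φ => ∑ x, ∑ y, g x y φ) s = ∑ x, ∑ y, num blk Δ f (g x y) s := by
  simp only [num, Finset.sum_mul]
  rw [integral_finsetSum _ fun x _ => integrable_finsetSum _ fun y _ => hg x y]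
  exact Finset.sum_congr rfl fun x _ => integral_finsetSum _ fun y _ => hg x y

end Num

end Literature.MathematicalPhysics.QuantumFieldTheory.BalabanImbrieJaffe1984to88.BIJ88DexpCondMean305

end
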